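import Literature.MathematicalPhysics.QuantumFieldTheory.Balaban1983to89.T4ShellMeasureDet
import Literature.MathematicalPhysics.QuantumFieldTheory.Balaban1983to89.T4DressedR

/-!
# N21 (NE7c), strategy s3 «alternative currency», file 24 — THE INSERT-FIBRE SHELL (LENS nearmiss g12 ROW M = Cards 35 + 36 and g13 §J «the two lineages
# meet», landed verbatim with credit): (M1) for a (1.100)-shaped term ⇐ FIBREWISE (M1) for its insert NUMERATOR alone; the block-sup's union bound; weak
# fibre dependence = an enlarged shell; the JUNCTION with pub-balaban's `T4ShellMeasureDet` §4 (Card 35's `hfib` IS its per-exterior (M1), literally);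
# and the LÉVY-CONCENTRATION DICTIONARY (a concentration-function bound for the tested variable IS (M1))

PROVENANCE AND CREDIT.  §M ∕ §M′ ∕ §C of this module are the planner seat `ym-lens-BalabanUVNodes-nearmiss`'s `Sketch-nearmiss-g12.lean` §M + §M′ + §C
(sha16 e6983e2e0315f640; memo `LENS-nearmiss.md` v12.0 sha16 0ce22440a127f1e5, Cards 35∕36; bus l.18639, FAN-OUT v12.0 ROW M «20p … suggested owner
dag-n21-d g6 after 20o∕20o′, else dag-n21-e»), and §J is the same seat's `Sketch-nearmiss-g13.lean` §J1–§J2′ (sha16 2359723bfc884d48; bus LOCATED-JUNCTION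
l.18911 «ASK … 20p's header CITES `T4ShellMeasureDet.slotAntiConcentration_realized_of_sections` … and — if you like — takes §J1∕§J2 as the JUNCTION»),
all landed VERBATIM by seat `pub-ymgap-dag-n21-e` (g9; n21-d g6 ■ l.18789 without 20p; TAKE-M∕H l.18840; dag-lead DEDUP-275 (15) GO + REBALANCE-70 l.18881);
the filer's only changes: this header, the namespace, the import list cut to the two Literature modules the sections use (`T4ShellMeasureDet` — whose cone
carries `T4ShellMeasure`'s wall predicate `SlotAntiConcentration` :598 and the chart ∕ block-law vocabulary `blockLaw`, `measurable_section`,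
`slotAntiConcentration_realized_of_sections` :443 —, and `T4DressedR` for `FibreIndep` :296, which carries `B15BasicStep`'s `IndepOf` ∕
`lmarginal_mul_of_indepOf` ∕ `fibreIntegral` ∕ `fieldMeasure_eq_pi` ∕ `lmarginal_ofReal_le`), and ONE rename: the lens g13 §J2′ re-derivation keeps the g12
name in the sketch; here it is `slotAntiConcentration_fieldMeasure_of_fibrewise_ennreal` (ENNReal currency `num Fx : GaugeField → ℝ≥0∞`, `IndepOf s Fx`)
next to the g12 real-`Density` edition `slotAntiConcentration_fieldMeasure_of_fibrewise`.  LITERATURE TWIN OF M-a′ (lens g13 erratum, cited BY NAME):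
pub-balaban's `T4ShellMeasureDet.slotAntiConcentration_realized_of_sections` (08-19) — with `slotAntiConcentration_realized_local` ∕
`slot_field_realized_placed` its chart-local and slot-ledger forms — is, measure-theoretically, Card 35's first step; §J makes the identification a
kernel `↔` and re-derives M-a′ from it in ENNReal letters.  Lane: `--kind proof --supports stmt-QuantumFields-20296 --as helper` (K3⁵
`SpineGivenEndpointR13SepCoP`, plan g68 KEY-20 l.18802 ∕ dag-lead WORDS-141 l.18811).  Companion: file 25 `…N21FibreFubiniOdds` (ROW H = §H, Card 34).  Count-neutral.

THE CONTENT (lens §M ∕ §M′ ∕ §C).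
§M  CARD 35 — (M1) FOR A (1.100)-SHAPED TERM ⇐ FIBREWISE (M1) FOR ITS INSERT NUMERATOR ALONE.  Over a finite product (`Measure.pi`, Mathlib
    `lmarginal` = `∫⋯∫⁻_s`): a term `num · R` with `B15.BasicStep.IndepOf s R` (the normalising denominator `1/∫⌈num`, the old operation, the other
    components, OFF indicators all ride in `R`) satisfies `SlotAntiConcentration ((Measure.pi μ).withDensity (num·R)) u θ ρ D` as soon as
    `∫⌈_s 𝟙_shell(u)·num ≤ D·ρ·∫⌈_s num` pointwise in the exterior (★★ `slotAntiConcentration_pi_withDensity_of_fibrewise`; mechanism: Mathlib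
    `lintegral_le_of_lmarginal_le` + the `IndepOf` pull-out; NO hypothesis on the denominator — the dissolution of lens Card 32's denominator
    kill-test for ON slots).  (M-b) the block-sup costs one union bound over the tested plaquettes (`slotAntiConcentration_iSup`, constant `Σ_p D_p`);
    (M-c) weak dependence on the fibre = an enlarged shell for a surrogate (`shell_subset_shell_of_near`, `measure_shell_le_of_near`).
§M′ the same in the record's (1.100) currency — `Setup.fieldMeasure`, real `Density`, `B15.BasicStep.fibreIntegral`, `T4DressedR.FibreIndep`
    (★★ `slotAntiConcentration_fieldMeasure_of_fibrewise`) — pluggable into `B15Sect1Statements.Insert1100` (`ratio = num/den`, `den = fibreIntegral lam num`).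
§J  THE JUNCTION (lens g13 §J1–§J2′, «the two lineages meet»): the `lmarginal` over product Haar on `s` IS the `lintegral` of the section against
    `T4ShellMeasureDet.blockLaw s` (`lmarginal_haar_eq_lintegral_blockLaw`, `rfl`; real edition `fibreIntegral_eq_toReal_lintegral_blockLaw`); the
    section-tilted block law's shell mass ∕ total mass are the fibre integrals of `𝟙_shell·num` ∕ `num` (`withDensity_blockLaw_apply_shell` ∕ `_univ`);
    hence ★ `slotAntiConcentration_blockLaw_iff`: (M1) for `(blockLaw s).withDensity (num-section)` tested on the section of `u` — the hypothesis of
    `T4ShellMeasureDet.slotAntiConcentration_realized_of_sections` — ⟺ Card 35's fibrewise bound `hfib` at that exterior; and M-a′ RE-DERIVED from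
    `slotAntiConcentration_realized_of_sections` (`slotAntiConcentration_fieldMeasure_of_fibrewise_ennreal`).  So every producer of (M1) for a block
    law in the tree (`T4ShellMeasureDet.slotAntiConcentration_realized_local` on the local dilation road, `T4ShellMeasure*`'s transversal ∕ fibred ∕
    fibre-alternative members, this seat's threshold-mixture `…N21ThresholdMixture.slotAntiConcentration_thresholdMixture`) feeds M-a ∕ M-a′ BY NAME.
§C  CARD 36 — THE LÉVY-CONCENTRATION DICTIONARY: `ν{|u − x₀| ≤ ε} ≤ K·ε·ν(univ)` for all centres ⇒ (M1) with `D = K·θ/2`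
    (★ `slotAntiConcentration_of_levyConcentration`).  Where the constant then comes from is the located analytic question: for suprema of
    Gaussian-comparable families `K = O(√log n)` (Chernozhukov–Chetverikov–Kato, Ann. Stat. 42 (2014) Thm 2.1 ∕ Nazarov's inequality — NOT in the
    tree, NOT claimed) instead of the union bound's `O(n)` of (M-b); lens KT-36a (the comparison of the χ-truncated fibre law with a Gaussian one) is
    NOT PRINTED.  The tree's own producers of the `hlevy` ∕ `hfib` shapes are `T4ShellMeasure.slotAntiConcentration_of_transversal` (transversal
    coordinate + `DensityBound`), `T4ShellMeasureFibre.slotAntiConcentration_of_fibred(_oneSided)` (dilation coordinate + two-sided decay) and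
    `T4ShellMeasureAnalytic.slotAntiConcentration_of_fibreAlternative` — each applicable to the FIBRE LAW `num(V ← ·)·Haar^s` of §M′ at a frozen exterior.

HONEST FRAMING.  NE7c is NOT PRINTED and NOT PROVED.  [folklore] `lmarginal` ∕ measure bookkeeping over landed carriers; `hfib` and `hlevy` are
hypothesis SHAPES = exactly the unprinted estimates ((M1) on the insert's fibre law at every frozen exterior; a concentration-function bound for the
block-sup statistic); nothing of Bałaban's asserted; N21 NOT discharged; counts UNMOVED; count-neutral; one finite 𝕋⁴ at fixed `ε`; NOT ℝ⁴ ∕ OS ∕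
mass gap ∕ Clay.

CITATION HEADER (lean-in-tree rule 2026-08-18).  BY NAME: `T4ShellMeasure.SlotAntiConcentration` (:598); `T4ShellMeasureDet.blockLaw` ∕ `measurable_section` ∕
`slotAntiConcentration_realized_of_sections` (:443); `B15.BasicStep.IndepOf` ∕ `lmarginal_mul_of_indepOf` ∕ `fibreIntegral` ∕ `fieldMeasure_eq_pi` ∕
`lmarginal_ofReal_le` ∕ `ofReal_comp_measurable`; `T4DressedR.FibreIndep` (:296); Mathlib `MeasureTheory.lmarginal`, `updateFinset`,
`lintegral_le_of_lmarginal_le`, `withDensity_apply`, `measure_iUnion_fintype_le`, `exists_eq_ciSup_of_finite`.  Context only (SHAPE, nothing asserted):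
[Balaban1989LargeFieldI] (0.3)–(0.4) p. 176, (1.100) p. 198 (the term shape `num·F`); [Balaban1988Convergent] (2.17)–(2.18) p. 257 (the block-sup
statistic and its threshold shell).

WHAT IS PROVED ([folklore]; lens g12 §M ∕ §M′ ∕ §C and g13 §J1–§J2′; 12 theorems, 0 `def`).  §M ★★ `slotAntiConcentration_pi_withDensity_of_fibrewise` ·
`slotAntiConcentration_iSup` · `shell_subset_shell_of_near` · `measure_shell_le_of_near`; §M′ ★★ `slotAntiConcentration_fieldMeasure_of_fibrewise`; §J
`lmarginal_haar_eq_lintegral_blockLaw` · `fibreIntegral_eq_toReal_lintegral_blockLaw` · `withDensity_blockLaw_apply_shell` · `withDensity_blockLaw_apply_univ` ·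
★ `slotAntiConcentration_blockLaw_iff` · `slotAntiConcentration_fieldMeasure_of_fibrewise_ennreal`; §C ★ `slotAntiConcentration_of_levyConcentration`.
-/

set_option autoImplicit false

noncomputable section

namespace Summit.QuantumFields.YangMills.Theorems.N21InsertFibreShell

open Literature.MathematicalPhysics.QuantumFieldTheory.Balaban1983to89
open Literature.MathematicalPhysics.QuantumFieldTheory.Balaban1983to89.T4DressedR (FibreIndep)

/-! ## §M  Card 35: (M1) for a (1.100)-shaped term ⇐ FIBREWISE (M1) for its insert NUMERATOR alone;
    the block-sup statistic: one union bound over the tested plaquettes -/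

section INSERT

open MeasureTheory Set
open scoped ENNReal
open Literature.MathematicalPhysics.QuantumFieldTheory.Balaban1983to89.T4ShellMeasure (SlotAntiConcentration)
open Literature.MathematicalPhysics.QuantumFieldTheory.Balaban1983to89.B15.BasicStep (IndepOf lmarginal_mul_of_indepOf)

variable {δ : Type*} [DecidableEq δ] [Fintype δ] {X : δ → Type*} [∀ i, MeasurableSpace (X i)]
  (μ : ∀ i, Measure (X i)) [∀ i, SigmaFinite (μ i)]

/-- ★★ (M-a) **INSERT ANTICONCENTRATION ⇒ (M1) FOR THE TERM.**  A term of the (1.100) shape — an insert numerator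
`num` (the fresh small-field density on the fibre `s = Λ_i`) times ANY factor `R` independent of the fibre variables
(the normalising denominator `1/∫⌈num`, the old integrated-out operation, the other components' inserts, the OFF cubes'
indicator factors: `B15.BasicStep.lmarginal_norm_term`'s `N/den`) — satisfies the (M1) inequality
`T4ShellMeasure.SlotAntiConcentration` for a tested variable `u` with constant `D` as soon as, AT EVERY FROZEN EXTERIOR,
the fibre law `num(V ← ·)·Haar^s` puts mass `≤ D·ρ ×` its own mass on the shell of `u(V ← ·)`.  Neither `den ≠ 0` nor a
two-sided bound on `den` is used: the denominator RIDES as a section constant (the dissolution of Card 32's kill-test (ε)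
for ON slots).  Mechanism: `lintegral_le_of_lmarginal_le` + the `IndepOf` pull-out. [folklore] -/
theorem slotAntiConcentration_pi_withDensity_of_fibrewise (s : Finset δ) {num R : (∀ i, X i) → ℝ≥0∞}
    (hnum : Measurable num) (hR : Measurable R) (hRind : IndepOf s R) {u : (∀ i, X i) → ℝ} (hu : Measurable u)
    {θ ρ D : ℝ}
    (hfib : ∀ V, (∫⋯∫⁻_s, (fun U => {x | θ * (1 - ρ) ≤ u x ∧ u x < θ}.indicator 1 U * num U) ∂μ) V
      ≤ ENNReal.ofReal (D * ρ) * (∫⋯∫⁻_s, num ∂μ) V) :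
    SlotAntiConcentration ((Measure.pi μ).withDensity fun V => num V * R V) u θ ρ D := by
  have hS : MeasurableSet {x : ∀ i, X i | θ * (1 - ρ) ≤ u x ∧ u x < θ} :=
    (measurableSet_le measurable_const hu).inter (measurableSet_lt hu measurable_const)
  have hind_m : Measurable fun U : ∀ i, X i => {x | θ * (1 - ρ) ≤ u x ∧ u x < θ}.indicator (1 : (∀ i, X i) → ℝ≥0∞) U :=
    measurable_one.indicator hS
  unfold SlotAntiConcentration
  rw [withDensity_apply _ hS, withDensity_apply _ MeasurableSet.univ, Measure.restrict_univ, ← lintegral_indicator hS,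
    ← lintegral_const_mul (ENNReal.ofReal (D * ρ)) (f := fun a => num a * R a) (hnum.mul hR)]
  have hind : (fun V => {x : ∀ i, X i | θ * (1 - ρ) ≤ u x ∧ u x < θ}.indicator (fun V => num V * R V) V)
      = R * ((fun V => {x | θ * (1 - ρ) ≤ u x ∧ u x < θ}.indicator (1 : (∀ i, X i) → ℝ≥0∞) V) * num) := by
    funext V
    by_cases hV : V ∈ {x : ∀ i, X i | θ * (1 - ρ) ≤ u x ∧ u x < θ}
    · simp only [indicator_of_mem hV, Pi.mul_apply, Pi.one_apply, one_mul]
      exact mul_comm _ _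
    · simp only [indicator_of_notMem hV, Pi.mul_apply, zero_mul, mul_zero]
  have hrhs : (fun V => ENNReal.ofReal (D * ρ) * (num V * R V)) = R * ((fun _ => ENNReal.ofReal (D * ρ)) * num) := by
    funext V
    simp only [Pi.mul_apply]
    ring
  rw [hind, hrhs]
  refine lintegral_le_of_lmarginal_le s (hR.mul (hind_m.mul hnum)) (hR.mul (measurable_const.mul hnum)) ?_
  rw [lmarginal_mul_of_indepOf s hRind (hind_m.mul hnum), lmarginal_mul_of_indepOf s hRind (measurable_const.mul hnum),
    lmarginal_mul_of_indepOf s (f := fun _ => ENNReal.ofReal (D * ρ)) (fun _ _ => rfl) hnum]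
  intro V
  simp only [Pi.mul_apply]
  exact mul_le_mul_right (hfib V) _

variable {Ω : Type*} [MeasurableSpace Ω]

/-- (M-b) **THE BLOCK-SUP COSTS ONE UNION BOUND OVER THE TESTED PLAQUETTES.**  If every plaquette variable `v p` of a
finite nonempty family satisfies (M1) at `(θ, ρ)` with constant `D p ≥ 0`, their sup satisfies (M1) with `Σ_p D p`:
the shell of the sup lies in the union of the shells (the sup is attained; `sup < θ` bounds every member). [folklore] -/
theorem slotAntiConcentration_iSup {ι : Type*} [Fintype ι] [Nonempty ι] (ν : Measure Ω) {v : ι → Ω → ℝ}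
    {θ ρ : ℝ} {D : ι → ℝ} (hD : ∀ p, 0 ≤ D p) (h : ∀ p, SlotAntiConcentration ν (v p) θ ρ (D p)) :
    SlotAntiConcentration ν (fun x => ⨆ p, v p x) θ ρ (∑ p, D p) := by
  unfold SlotAntiConcentration at h ⊢
  have hsub : {x | θ * (1 - ρ) ≤ (⨆ p, v p x) ∧ (⨆ p, v p x) < θ} ⊆ ⋃ p, {x | θ * (1 - ρ) ≤ v p x ∧ v p x < θ} := by
    rintro x ⟨h1, h2⟩
    obtain ⟨p, hp⟩ := exists_eq_ciSup_of_finite (f := fun p => v p x)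
    refine mem_iUnion.2 ⟨p, ?_, ?_⟩
    · rw [hp]; exact h1
    · exact (le_ciSup (Finite.bddAbove_range fun p => v p x) p).trans_lt h2
  calc ν {x | θ * (1 - ρ) ≤ (⨆ p, v p x) ∧ (⨆ p, v p x) < θ}
      ≤ ν (⋃ p, {x | θ * (1 - ρ) ≤ v p x ∧ v p x < θ}) := measure_mono hsub
    _ ≤ ∑ p, ν {x | θ * (1 - ρ) ≤ v p x ∧ v p x < θ} := measure_iUnion_fintype_le ν _
    _ ≤ ∑ p, ENNReal.ofReal (D p * ρ) * ν univ := Finset.sum_le_sum fun p _ => h p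
    _ = ENNReal.ofReal ((∑ p, D p) * ρ) * ν univ := by
        rw [ENNReal.ofReal_mul (Finset.sum_nonneg fun p _ => hD p), ENNReal.ofReal_sum_of_nonneg fun p _ => hD p,
          Finset.sum_mul, Finset.sum_mul]
        refine Finset.sum_congr rfl fun p _ => ?_
        rw [ENNReal.ofReal_mul (hD p)]

omit [MeasurableSpace Ω] in
/-- (M-c) **WEAK DEPENDENCE IS AN ENLARGED SHELL.**  If the tested variable `u` is uniformly within `θ·η` of a SURROGATE
`ū` (the same statistic with the fibre variables frozen — the OFF reading of an ON cube whose sup is carried far from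
the fibre; `η` = the sup-norm influence of the fibre on `u`, relative to the threshold), then the `(θ, ρ)`-shell of `u`
lies in the `(θ(1+η), (ρ+2η)/(1+η))`-shell of `ū`; so (M1) for `ū` at the enlarged window gives (M1) for `u`
(constant rescaled by `(ρ + 2η)/((1+η)ρ)`).  The dichotomy of Card 35: transversal share ⇒ (M-a); small influence ⇒ this. [folklore] -/
theorem shell_subset_shell_of_near (u ū : Ω → ℝ) {θ ρ η : ℝ} (hnear : ∀ x, |u x - ū x| ≤ θ * η) :
    {x | θ * (1 - ρ) ≤ u x ∧ u x < θ} ⊆ {x | θ * (1 - ρ) - θ * η ≤ ū x ∧ ū x < θ + θ * η} := by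
  rintro x ⟨h1, h2⟩
  have h := hnear x
  rw [abs_le] at h
  exact ⟨by linarith [h.2], by linarith [h.1]⟩

/-- (M-c′) … in (M1) letters: (M1) for the surrogate `ū` on the enlarged window `[θ(1−ρ) − θη, θ(1+η))` — written as the
`(θ′, ρ′)`-shell with `θ′ = θ(1+η)`, `θ′(1−ρ′) = θ(1−ρ−η)` — gives the shell-mass bound for `u` with the surrogate's
constant and the enlarged relative width. [folklore] -/
theorem measure_shell_le_of_near (ν : Measure Ω) (u ū : Ω → ℝ) {θ ρ η θ' ρ' D' : ℝ}
    (hnear : ∀ x, |u x - ū x| ≤ θ * η) (hθ' : θ' = θ * (1 + η)) (hρ' : θ' * (1 - ρ') = θ * (1 - ρ) - θ * η)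
    (hū : SlotAntiConcentration ν ū θ' ρ' D') :
    ν {x | θ * (1 - ρ) ≤ u x ∧ u x < θ} ≤ ENNReal.ofReal (D' * ρ') * ν univ := by
  refine (measure_mono ((shell_subset_shell_of_near u ū hnear).trans ?_)).trans hū
  rintro x ⟨h1, h2⟩
  refine ⟨by rw [hρ']; exact h1, by rw [hθ']; linarith⟩

end INSERT

/-! ### §M′  The same in the record's (1.100) currency: `Setup.fieldMeasure`, real `Density`, `B15.BasicStep.fibreIntegral`,
    `T4DressedR.FibreIndep` — pluggable into `B15Sect1Statements.Insert1100` (`ratio = num/den`, `den = fibreIntegral lam num`) -/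

section INSERT_REAL

open MeasureTheory Set
open scoped ENNReal
open Literature.MathematicalPhysics.QuantumFieldTheory.Balaban1983to89.T4ShellMeasure (SlotAntiConcentration)
open Literature.MathematicalPhysics.QuantumFieldTheory.Balaban1983to89.B15.BasicStep
  (fibreIntegral fieldMeasure_eq_pi lmarginal_ofReal_le ofReal_comp_measurable)

variable {P : Params} {j : ℕ} {G : Type*} [GaugeGroup G] [MeasurableSpace G] [HaarData G] [DecidableEq (PBond P j)]

/-- ★★ (M-a′) **CARD 35's FIRST STEP, (1.100) LETTERS.**  A term `num · F` of the renormalised density — `num` the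
component's insert numerator on its fibre `s = Λ_i` (measurable, `0 ≤ num ≤ C`), `F ≥ 0` measurable and
`FibreIndep s F` (everything else: `1/den` with `den = fibreIntegral s num`, the old operation `∫⌈old`, the other
components, the OFF-cube indicators) — obeys (M1) for `u` with constant `D` under `fieldMeasure.withDensity`, PROVIDED the
insert's own fibre law anticoncentrates `u` at every frozen exterior:
`∫⌈_s 𝟙_shell(u)·num ≤ D·ρ·∫⌈_s num` pointwise in the exterior variables.  No hypothesis on `den`. [folklore] -/
theorem slotAntiConcentration_fieldMeasure_of_fibrewise (s : Finset (PBond P j)) {num F : Density P j G}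
    (hnum_m : Measurable num) (hnum0 : ∀ V, 0 ≤ num V) {C : ℝ} (hnumC : ∀ V, num V ≤ C)
    (hF_m : Measurable F) (hFind : T4DressedR.FibreIndep s F)
    {u : GaugeField P j G → ℝ} (hu : Measurable u) {θ ρ D : ℝ} (hDρ : 0 ≤ D * ρ)
    (hfib : ∀ V, fibreIntegral s (fun U => {x | θ * (1 - ρ) ≤ u x ∧ u x < θ}.indicator (1 : Density P j G) U * num U) V
      ≤ D * ρ * fibreIntegral s num V) :
    SlotAntiConcentration ((fieldMeasure P j G).withDensity fun V => ENNReal.ofReal (num V * F V)) u θ ρ D := by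
  have hdens : (fun V => ENNReal.ofReal (num V * F V)) = fun V => ENNReal.ofReal (num V) * ENNReal.ofReal (F V) := by
    funext V; exact ENNReal.ofReal_mul (hnum0 V)
  rw [hdens, fieldMeasure_eq_pi]
  refine slotAntiConcentration_pi_withDensity_of_fibrewise (fun _ : PBond P j => (HaarData.haar : Measure G)) s
    (ofReal_comp_measurable hnum_m) (ofReal_comp_measurable hF_m) (fun x y => congrArg ENNReal.ofReal (hFind x y)) hu ?_
  intro V
  have hpt : (fun U => {x | θ * (1 - ρ) ≤ u x ∧ u x < θ}.indicator (1 : GaugeField P j G → ℝ≥0∞) U * ENNReal.ofReal (num U))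
      = fun U => ENNReal.ofReal ({x | θ * (1 - ρ) ≤ u x ∧ u x < θ}.indicator (1 : Density P j G) U * num U) := by
    funext U
    by_cases hU : U ∈ {x : GaugeField P j G | θ * (1 - ρ) ≤ u x ∧ u x < θ}
    · simp only [indicator_of_mem hU, Pi.one_apply, one_mul]
    · simp only [indicator_of_notMem hU, zero_mul, ENNReal.ofReal_zero]
  refine (congrFun (congrArg (fun f => ∫⋯∫⁻_s, f ∂(fun _ : PBond P j => (HaarData.haar : Measure G))) hpt) V).trans_le ?_
  have hind_le : ∀ U, {x | θ * (1 - ρ) ≤ u x ∧ u x < θ}.indicator (1 : Density P j G) U * num U ≤ C := by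
    intro U
    by_cases hU : U ∈ {x : GaugeField P j G | θ * (1 - ρ) ≤ u x ∧ u x < θ}
    · simp only [indicator_of_mem hU, Pi.one_apply, one_mul]; exact hnumC U
    · simp only [indicator_of_notMem hU, zero_mul]; exact (hnum0 U).trans (hnumC U)
  have htop1 := ne_top_of_le_ne_top ENNReal.ofReal_ne_top (lmarginal_ofReal_le s hind_le V)
  have htop2 := ne_top_of_le_ne_top ENNReal.ofReal_ne_top (lmarginal_ofReal_le s hnumC V)
  have h := hfib V
  simp only [fibreIntegral] at h
  calc (∫⋯∫⁻_s, (fun U => ENNReal.ofReal ({x | θ * (1 - ρ) ≤ u x ∧ u x < θ}.indicator (1 : Density P j G) U * num U))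
          ∂(fun _ : PBond P j => (HaarData.haar : Measure G))) V
      = ENNReal.ofReal ((∫⋯∫⁻_s, (fun U => ENNReal.ofReal ({x | θ * (1 - ρ) ≤ u x ∧ u x < θ}.indicator
          (1 : Density P j G) U * num U)) ∂(fun _ : PBond P j => (HaarData.haar : Measure G))) V).toReal :=
        (ENNReal.ofReal_toReal htop1).symm
    _ ≤ ENNReal.ofReal (D * ρ * ((∫⋯∫⁻_s, (fun U => ENNReal.ofReal (num U))
          ∂(fun _ : PBond P j => (HaarData.haar : Measure G))) V).toReal) := ENNReal.ofReal_le_ofReal h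
    _ = ENNReal.ofReal (D * ρ) * (∫⋯∫⁻_s, (fun U => ENNReal.ofReal (num U))
          ∂(fun _ : PBond P j => (HaarData.haar : Measure G))) V := by
        rw [ENNReal.ofReal_mul hDρ, ENNReal.ofReal_toReal htop2]

end INSERT_REAL

/-! ## §J  THE JUNCTION (LENS nearmiss g13 §J1–§J2′, landed verbatim with credit): Card 35's fibrewise hypothesis `hfib` IS, literally,
    the per-exterior (M1) of pub-balaban's `T4ShellMeasureDet` §4 (`slotAntiConcentration_realized_of_sections` :443) for the block law
    tilted by the section density — the histories road (20h∕20k∕20m∕20n) and the (γ_loc) chain speak ONE (M1) currency -/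

section JUNCTION

open MeasureTheory Set Function
open scoped ENNReal NNReal
open T4ShellMeasure (SlotAntiConcentration)
open T4ShellMeasureDet
open B15.BasicStep (fibreIntegral IndepOf lmarginal_mul_of_indepOf)

variable {P : Params} {j : ℕ} {G : Type*} [GaugeGroup G] [MeasurableSpace G] [HaarData G]
  [DecidableEq (PBond P j)]

/-! ## §J1  the (1.100) fibre integral over `s` IS the `blockLaw s`-integral of the section -/

/-- §J1 `lmarginal` over product Haar on `s` = `lintegral` of the section against `blockLaw s` (definitional).
[folklore] -/
theorem lmarginal_haar_eq_lintegral_blockLaw (s : Finset (PBond P j)) (f : GaugeField P j G → ℝ≥0∞)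
    (V : GaugeField P j G) :
    (∫⋯∫⁻_s, f ∂fun _ : PBond P j => (HaarData.haar : Measure G)) V
      = ∫⁻ y, f (updateFinset V s y) ∂(blockLaw (G := G) s) := rfl

/-- §J1′ the real (1.100) fibre integral `B15.BasicStep.fibreIntegral` in the same letters. [folklore] -/
theorem fibreIntegral_eq_toReal_lintegral_blockLaw (s : Finset (PBond P j)) (f : Density P j G)
    (V : GaugeField P j G) :
    fibreIntegral s f V = (∫⁻ y, ENNReal.ofReal (f (updateFinset V s y)) ∂(blockLaw (G := G) s)).toReal := rfl

/-! ## §J2  Card 35's fibrewise shell bound ⟺ `T4ShellMeasureDet` §4's per-exterior (M1) -/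

/-- the section-tilted block law of the section shell event = the fibre integral of `1_shell · num`. [folklore] -/
theorem withDensity_blockLaw_apply_shell (s : Finset (PBond P j)) {num : GaugeField P j G → ℝ≥0∞}
    {u : GaugeField P j G → ℝ} (hu : Measurable u) (θ ρ : ℝ) (V : GaugeField P j G) :
    ((blockLaw s).withDensity fun y => num (updateFinset V s y))
        {y | θ * (1 - ρ) ≤ u (updateFinset V s y) ∧ u (updateFinset V s y) < θ}
      = (∫⋯∫⁻_s, Set.indicator {U | θ * (1 - ρ) ≤ u U ∧ u U < θ} num
          ∂fun _ : PBond P j => (HaarData.haar : Measure G)) V := by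
  have hS : MeasurableSet {y : ↥s → G | θ * (1 - ρ) ≤ u (updateFinset V s y) ∧ u (updateFinset V s y) < θ} :=
    (measurableSet_le measurable_const (measurable_section s hu V)).inter
      (measurableSet_lt (measurable_section s hu V) measurable_const)
  rw [withDensity_apply _ hS, ← lintegral_indicator hS, lmarginal_haar_eq_lintegral_blockLaw]
  refine lintegral_congr fun y => ?_
  simp only [Set.indicator_apply, Set.mem_setOf_eq]

/-- the section-tilted block law's total mass = the fibre integral of `num`. [folklore] -/
theorem withDensity_blockLaw_apply_univ (s : Finset (PBond P j)) (num : GaugeField P j G → ℝ≥0∞)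
    (V : GaugeField P j G) :
    ((blockLaw s).withDensity fun y => num (updateFinset V s y)) univ
      = (∫⋯∫⁻_s, num ∂fun _ : PBond P j => (HaarData.haar : Measure G)) V := by
  rw [withDensity_apply _ MeasurableSet.univ, setLIntegral_univ, lmarginal_haar_eq_lintegral_blockLaw]

/-- §J2 ★ the two currencies are ONE statement: (M1) for the block law tilted by the section density, tested on the
section of `u` (the hypothesis of `T4ShellMeasureDet.slotAntiConcentration_realized_of_sections`) ⟺ the fibrewise
shell bound `∫⌈_s 1_shell·num ≤ D·ρ·∫⌈_s num` at the exterior `V` (the hypothesis `hfib` of Card 35, ENNReal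
currency). [folklore] -/
theorem slotAntiConcentration_blockLaw_iff (s : Finset (PBond P j)) {num : GaugeField P j G → ℝ≥0∞}
    {u : GaugeField P j G → ℝ} (hu : Measurable u) (θ ρ D : ℝ) (V : GaugeField P j G) :
    SlotAntiConcentration ((blockLaw s).withDensity fun y => num (updateFinset V s y))
        (fun y => u (updateFinset V s y)) θ ρ D
      ↔ (∫⋯∫⁻_s, Set.indicator {U | θ * (1 - ρ) ≤ u U ∧ u U < θ} num
            ∂fun _ : PBond P j => (HaarData.haar : Measure G)) V
          ≤ ENNReal.ofReal (D * ρ) * (∫⋯∫⁻_s, num ∂fun _ : PBond P j => (HaarData.haar : Measure G)) V := by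
  rw [SlotAntiConcentration, withDensity_blockLaw_apply_shell s (num := num) hu θ ρ V,
    withDensity_blockLaw_apply_univ s num V]

/-- §J2′ (ERRATUM MADE KERNEL) Card 35 = `Sketch-g12 §M′` is a corollary of `T4ShellMeasureDet` §4: (M1) for the
realized (1.100) term law `fieldMeasure.withDensity (num · Fx)`, `Fx` NOT reading the block `s` (`IndepOf s Fx`: the
earlier operations' ratios, `oldOp`, the slot-free part of the density — ANY size), from the fibrewise shell bound for
`num` alone, SAME constant. [folklore] -/
theorem slotAntiConcentration_fieldMeasure_of_fibrewise_ennreal (s : Finset (PBond P j))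
    {num Fx : GaugeField P j G → ℝ≥0∞} (hnum : Measurable num) (hFx : Measurable Fx) (hind : IndepOf s Fx)
    {u : GaugeField P j G → ℝ} (hu : Measurable u) {θ ρ D : ℝ}
    (hfib : ∀ V : GaugeField P j G,
      (∫⋯∫⁻_s, Set.indicator {U | θ * (1 - ρ) ≤ u U ∧ u U < θ} num
          ∂fun _ : PBond P j => (HaarData.haar : Measure G)) V
        ≤ ENNReal.ofReal (D * ρ) * (∫⋯∫⁻_s, num ∂fun _ : PBond P j => (HaarData.haar : Measure G)) V) :
    SlotAntiConcentration ((fieldMeasure P j G).withDensity fun U => num U * Fx U) u θ ρ D := by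
  refine slotAntiConcentration_realized_of_sections s (hnum.mul hFx) hu fun V => ?_
  refine (slotAntiConcentration_blockLaw_iff s (num := fun U => num U * Fx U) hu θ ρ D V).2 ?_
  have e1 : Set.indicator {U | θ * (1 - ρ) ≤ u U ∧ u U < θ} (fun U => num U * Fx U)
      = Fx * Set.indicator {U | θ * (1 - ρ) ≤ u U ∧ u U < θ} num :=
    funext fun U => by rw [Set.indicator_mul_left, Pi.mul_apply, mul_comm]
  have e2 : (fun U => num U * Fx U) = Fx * num := funext fun U => mul_comm _ _
  have hmeas : Measurable (Set.indicator {U | θ * (1 - ρ) ≤ u U ∧ u U < θ} num) :=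
    hnum.indicator ((measurableSet_le measurable_const hu).inter (measurableSet_lt hu measurable_const))
  have l1 : (∫⋯∫⁻_s, Set.indicator {U | θ * (1 - ρ) ≤ u U ∧ u U < θ} (fun U => num U * Fx U)
        ∂fun _ : PBond P j => (HaarData.haar : Measure G)) V
      = Fx V * (∫⋯∫⁻_s, Set.indicator {U | θ * (1 - ρ) ≤ u U ∧ u U < θ} num
        ∂fun _ : PBond P j => (HaarData.haar : Measure G)) V :=
    (congrArg (fun g : GaugeField P j G → ℝ≥0∞ =>
        (∫⋯∫⁻_s, g ∂fun _ : PBond P j => (HaarData.haar : Measure G)) V) e1).trans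
      (congrFun (lmarginal_mul_of_indepOf s hind hmeas) V)
  have l2 : (∫⋯∫⁻_s, (fun U => num U * Fx U) ∂fun _ : PBond P j => (HaarData.haar : Measure G)) V
      = Fx V * (∫⋯∫⁻_s, num ∂fun _ : PBond P j => (HaarData.haar : Measure G)) V :=
    (congrArg (fun g : GaugeField P j G → ℝ≥0∞ =>
        (∫⋯∫⁻_s, g ∂fun _ : PBond P j => (HaarData.haar : Measure G)) V) e2).trans
      (congrFun (lmarginal_mul_of_indepOf s hind hnum) V)
  calc (∫⋯∫⁻_s, Set.indicator {U | θ * (1 - ρ) ≤ u U ∧ u U < θ} (fun U => num U * Fx U)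
          ∂fun _ : PBond P j => (HaarData.haar : Measure G)) V
        = Fx V * (∫⋯∫⁻_s, Set.indicator {U | θ * (1 - ρ) ≤ u U ∧ u U < θ} num
          ∂fun _ : PBond P j => (HaarData.haar : Measure G)) V := l1
    _ ≤ Fx V * (ENNReal.ofReal (D * ρ) *
          (∫⋯∫⁻_s, num ∂fun _ : PBond P j => (HaarData.haar : Measure G)) V) := mul_le_mul' le_rfl (hfib V)
    _ = ENNReal.ofReal (D * ρ) *
          (Fx V * (∫⋯∫⁻_s, num ∂fun _ : PBond P j => (HaarData.haar : Measure G)) V) := mul_left_comm _ _ _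
    _ = ENNReal.ofReal (D * ρ) *
          (∫⋯∫⁻_s, (fun U => num U * Fx U) ∂fun _ : PBond P j => (HaarData.haar : Measure G)) V :=
        congrArg (ENNReal.ofReal (D * ρ) * ·) l2.symm

end JUNCTION

/-! ## §C  Card 36: the LÉVY-CONCENTRATION DICTIONARY — a bound on the concentration function of the tested variable
    (`p_ε(u) ≤ K·ε`, the object of Chernozhukov–Chetverikov–Kato, Ann. Stat. 42 (2014) Thm 2.1 for suprema of Gaussian
    processes: `K = 4(E sup + 1)/σ`, LOGARITHMIC in the number of tested plaquettes) IS (M1) with `D = K·θ/2` -/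

section LEVY

open MeasureTheory Set
open Literature.MathematicalPhysics.QuantumFieldTheory.Balaban1983to89.T4ShellMeasure (SlotAntiConcentration)

variable {Ω : Type*} [MeasurableSpace Ω]

/-- ★ (C) **LÉVY CONCENTRATION ⇒ (M1).**  If the law of `u` under `ν` has concentration function `ν{|u − x₀| ≤ ε} ≤ K·ε·ν(univ)`
for every centre `x₀` and radius `ε ≥ 0`, then `u` satisfies `SlotAntiConcentration ν u θ ρ (K·θ/2)` for every `θ, ρ ≥ 0`:
the shell `[θ(1−ρ), θ)` is inside the closed ball of centre `θ(1 − ρ/2)` and radius `θρ/2`.  The constant is then whatever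
the concentration bound gives — for the sup of `n` comparable Gaussian-like statistics `O(√log n)`, not `O(n)`. [folklore] -/
theorem slotAntiConcentration_of_levyConcentration (ν : Measure Ω) (u : Ω → ℝ) {K θ ρ : ℝ} (hθ : 0 ≤ θ) (hρ : 0 ≤ ρ)
    (hlevy : ∀ x₀ ε : ℝ, 0 ≤ ε → ν {x | |u x - x₀| ≤ ε} ≤ ENNReal.ofReal (K * ε) * ν univ) :
    SlotAntiConcentration ν u θ ρ (K * θ / 2) := by
  unfold SlotAntiConcentration
  have hsub : {x | θ * (1 - ρ) ≤ u x ∧ u x < θ} ⊆ {x | |u x - θ * (1 - ρ / 2)| ≤ θ * ρ / 2} := by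
    rintro x ⟨h1, h2⟩
    rw [mem_setOf_eq, abs_le]
    constructor <;> nlinarith
  calc ν {x | θ * (1 - ρ) ≤ u x ∧ u x < θ} ≤ ν {x | |u x - θ * (1 - ρ / 2)| ≤ θ * ρ / 2} := measure_mono hsub
    _ ≤ ENNReal.ofReal (K * (θ * ρ / 2)) * ν univ := hlevy _ _ (by positivity)
    _ = ENNReal.ofReal (K * θ / 2 * ρ) * ν univ := by ring_nf

end LEVY

end Summit.QuantumFields.YangMills.Theorems.N21InsertFibreShell
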